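import Summits.AnomalousDissipation.AnomalousDissipation.Theses.BoussinesqOctaves

/-!
# Birth skeleton (BC3) of child 2 `TowerClosing` of the tower split of `BoussinesqLadder`

Line ("shadow, then power follows"): the closing law splits into a SHADOWING statement with no power clause
(`stub_shadow`: every K41 forced-NS-Reynolds subsolution tower is eventually shadowed, in mean energy at the
dissipation scale `D√ν_n`, by exact time-periodic classical solutions forced by `f` alone — the hard, open stub:
a periodic-orbit existence/continuation problem near a certified approximate orbit, cf. the Newton–Kantorovich
computer-assisted periodic orbits of Navier–Stokes of BergBredenLessardVeen2021 and the Chow–Lin–Palmer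
shadowing lemma) and the CONTINUITY OF THE MEAN INJECTED POWER in the shadowing distance
(`stub_powerContinuity`: `⟨∫⟪f,b⟫⟩ ≤ ⟨∫⟪f,a⟫⟩ + ‖f‖₂ √⟨‖a − b‖₂²⟩`, Cauchy–Schwarz in space, Jensen for the
running means, `limsup` algebra; support-grade, provable now). The composition `TowerClosing_of` is real: the
tower's injection floor `ε` survives as `ε − ‖f‖₂ (D√ν_n)^{1/2} ≥ ε/2` for `n` large (`ν_n → 0`), so `θ = 1/2`.
-/

set_option linter.dupNamespace false
noncomputable section

open Set Function Filter Topology MeasureTheory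
open scoped InnerProductSpace
open Literature.Analysis.FunctionSpaces Literature.Analysis.FunctionSpaces.Torus
open Literature.Analysis.FluidPDE

namespace Summit.AnomalousDissipation.AnomalousDissipation.Cruxes.BoussinesqLadder.TowerClosingBirth

namespace TowerSplit

/-- **Child 1 — `K41Tower` (crux, ∃; the subsolution half).** One smooth steady divergence-free
mean-zero force `f`, a geometric ladder `ν_n = ν₀σⁿ` and, on EVERY rung, a `τ_n`-periodic classical
forced-NS-Reynolds subsolution `(U_n, P_n, R_n)` (Navier–Stokes at viscosity `ν_n` with force
`f + div R_n`, `R_n` jointly smooth, symmetric, `τ_n`-periodic) in the K41 class — mean-zero velocities,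
Kolmogorov gradient cap `‖∂ᵢU_n‖ ≤ A/√ν_n`, residual stress `‖R_n eⱼ‖ ≤ B√ν_n` — with ν-UNIFORM mean
energy `⟨‖U_n‖₂²⟩ ≤ E` and injection floor `⟨∫⟪f, U_n⟫⟩ ≥ ε > 0`. -/
def K41Tower : Prop :=
  ∃ f : UnitAddTorus (Fin 3) → EuclideanSpace ℝ (Fin 3), Literature.Analysis.FunctionSpaces.Torus.IsSmooth f ∧ Literature.Analysis.FunctionSpaces.Torus.IsDivFree f ∧ Literature.Analysis.FunctionSpaces.Torus.HasZeroMean f ∧ ∃ (ν₀ σ A B E ε : ℝ) (τ : ℕ → ℝ) (U : ℕ → ℝ → UnitAddTorus (Fin 3) → EuclideanSpace ℝ (Fin 3)) (P : ℕ → ℝ → UnitAddTorus (Fin 3) → ℝ) (R : ℕ → ℝ → UnitAddTorus (Fin 3) → Fin 3 → EuclideanSpace ℝ (Fin 3)), 0 < ν₀ ∧ 0 < σ ∧ σ < 1 ∧ 0 < ε ∧ ∀ n, 0 < τ n ∧ Function.Periodic (U n) (τ n) ∧ Function.Periodic (R n) (τ n) ∧ (∀ t, Literature.Analysis.FunctionSpaces.Torus.HasZeroMean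 (U n t)) ∧ Literature.Analysis.FunctionSpaces.Torus.IsSmoothSpaceTimeOn Set.univ (R n) ∧ (∀ t x (i j : Fin 3), R n t x i j = R n t x j i) ∧ Literature.Analysis.FunctionSpaces.Torus.IsClassicalNSSolutionOn Set.univ (ν₀ * σ ^ n) (fun t x => f x + Literature.Analysis.FluidPDE.Torus.tensorDivergence (R n t) x) (U n) (P n) ∧ (∀ t x (i : Fin 3), ‖Literature.Analysis.FunctionSpaces.Torus.partialDeriv i (U n t) x‖ ≤ A / Real.sqrt (ν₀ * σ ^ n)) ∧ (∀ t x (j : Fin 3), ‖R n t x j‖ ≤ B * Real.sqrt (ν₀ * σ ^ n)) ∧ Literature.Analysis.FluidPDE.meanEnergy (U n) ≤ E ∧ ε ≤ Literature.Analysis.FluidPDE.longTimeAvgSup (fun t => MeasureTheory.integral MeasureTheory.volume (fun x => inner ℝ (f x) (U n t x)))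

/-- **Child 2 — `TowerClosing` (crux, ∀∃; the closing law over the class of child 1).** For every
force, ladder and K41 forced-NS-Reynolds subsolution tower as in `K41Tower` there are `N`, `D`, `θ > 0`
and, for every rung `n ≥ N`, an EXACT `τ'_n`-periodic classical solution `(u_n, p_n)` of NS_{ν_n} forced
by `f` alone that shadows the tower within one dissipation-range octave in mean energy,
`⟨‖u_n − U_n‖₂²⟩ ≤ D√ν_n`, and absorbs the fraction `θ` of the injected power, `⟨∫⟪f, u_n⟫⟩ ≥ θε`. -/
def TowerClosing : Prop :=
  ∀ f : UnitAddTorus (Fin 3) → EuclideanSpace ℝ (Fin 3), Literature.Analysis.FunctionSpaces.Torus.IsSmooth f → Literature.Analysis.FunctionSpaces.Torus.IsDivFree f → Literature.Analysis.FunctionSpaces.Torus.HasZeroMean f → ∀ (ν₀ σ A B E ε : ℝ) (τ : ℕ → ℝ) (U : ℕ → ℝ → UnitAddTorus (Fin 3) → EuclideanSpace ℝ (Fin 3)) (P : ℕ → ℝ → UnitAddTorus (Fin 3) → ℝ) (R : ℕ → ℝ → UnitAddTorus (Fin 3) → Fin 3 → EuclideanSpace ℝ (Fin 3)), 0 < ν₀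 → 0 < σ → σ < 1 → 0 < ε → (∀ n, 0 < τ n ∧ Function.Periodic (U n) (τ n) ∧ Function.Periodic (R n) (τ n) ∧ (∀ t, Literature.Analysis.FunctionSpaces.Torus.HasZeroMean (U n t)) ∧ Literature.Analysis.FunctionSpaces.Torus.IsSmoothSpaceTimeOn Set.univ (R n) ∧ (∀ t x (i j : Fin 3), R n t x i j = R n t x j i) ∧ Literature.Analysis.FunctionSpaces.Torus.IsClassicalNSSolutionOn Set.univ (ν₀ * σ ^ n) (fun t x => f x + Literature.Analysis.FluidPDE.Torus.tensorDivergence (R n t) x) (U n) (P n) ∧ (∀ t x (i : Fin 3), ‖Literature.Analysis.FunctionSpaces.Torus.partialDeriv i (U n t) x‖ ≤ A / Real.sqrt (ν₀ * σ ^ n)) ∧ (∀ t x (j : Fin 3), ‖R n t x j‖ ≤ B * Real.sqrt (ν₀ * σ ^ n)) ∧ Literature.Analysis.FluidPDE.meanEnergy (U n) ≤ E ∧ ε ≤ Literature.Analysis.FluidPDE.longTimeAvgSup (fun t => MeasureTheory.integral MeasureTheory.volume (fun x => inner ℝ (f x) (U n t x)))) → ∃ (N : ℕ) (D θ : ℝ)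 (τ' : ℕ → ℝ) (u : ℕ → ℝ → UnitAddTorus (Fin 3) → EuclideanSpace ℝ (Fin 3)) (p : ℕ → ℝ → UnitAddTorus (Fin 3) → ℝ), 0 < θ ∧ ∀ n, N ≤ n → Literature.Analysis.FunctionSpaces.Torus.IsClassicalNSSolutionOn Set.univ (ν₀ * σ ^ n) (fun _ => f) (u n) (p n) ∧ 0 < τ' n ∧ Function.Periodic (u n) (τ' n) ∧ Literature.Analysis.FluidPDE.meanEnergy (u n - U n) ≤ D * Real.sqrt (ν₀ * σ ^ n) ∧ θ * ε ≤ Literature.Analysis.FluidPDE.longTimeAvgSup (fun t => MeasureTheory.integral MeasureTheory.volume (fun x => inner ℝ (f x) (u n t x)))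

end TowerSplit

/-- The K41 forced-NS-Reynolds subsolution tower matrix (exactly the hypothesis block of `TowerClosing` /
the `∀ n` block of `K41Tower`), abbreviated for the stubs of this skeleton. -/
def IsK41Tower (f : UnitAddTorus (Fin 3) → EuclideanSpace ℝ (Fin 3)) (ν₀ σ A B E ε : ℝ) (τ : ℕ → ℝ)
    (U : ℕ → ℝ → UnitAddTorus (Fin 3) → EuclideanSpace ℝ (Fin 3)) (P : ℕ → ℝ → UnitAddTorus (Fin 3) → ℝ)
    (R : ℕ → ℝ → UnitAddTorus (Fin 3) → Fin 3 → EuclideanSpace ℝ (Fin 3)) : Prop :=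
  ∀ n, 0 < τ n ∧ Function.Periodic (U n) (τ n) ∧ Function.Periodic (R n) (τ n) ∧ (∀ t, Literature.Analysis.FunctionSpaces.Torus.HasZeroMean (U n t)) ∧ Literature.Analysis.FunctionSpaces.Torus.IsSmoothSpaceTimeOn Set.univ (R n) ∧ (∀ t x (i j : Fin 3), R n t x i j = R n t x j i) ∧ Literature.Analysis.FunctionSpaces.Torus.IsClassicalNSSolutionOn Set.univ (ν₀ * σ ^ n) (fun t x => f x + Literature.Analysis.FluidPDE.Torus.tensorDivergence (R n t) x) (U n) (P n) ∧ (∀ t x (i : Fin 3), ‖Literature.Analysis.FunctionSpaces.Torus.partialDeriv i (U n t) x‖ ≤ A / Real.sqrt (ν₀ * σ ^ n)) ∧ (∀ t x (j : Fin 3), ‖R n t x j‖ ≤ B * Real.sqrt (ν₀ * σ ^ n)) ∧ Literature.Analysis.FluidPDE.meanEnergy (U n) ≤ E ∧ ε ≤ Literature.Analysis.FluidPDE.longTimeAvgSup (fun t => MeasureTheory.integral MeasureTheory.volume (fun x => inner ℝ (f x) (U n t x)))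

/-- **stub_shadow** (hardest; open) — every K41 forced-NS-Reynolds subsolution tower is eventually shadowed by
exact coherent states: for `n ≥ N` an exact `τ'_n`-periodic classical solution of NS_{ν_n} forced by `f` alone
within `⟨‖u_n − U_n‖₂²⟩ ≤ D√ν_n` of the tower (one dissipation-range octave). No power clause. -/
theorem stub_shadow : ∀ f : UnitAddTorus (Fin 3) → EuclideanSpace ℝ (Fin 3), IsSmooth f → IsDivFree f →
    HasZeroMean f → ∀ (ν₀ σ A B E ε : ℝ) (τ : ℕ → ℝ)
    (U : ℕ → ℝ → UnitAddTorus (Fin 3) → EuclideanSpace ℝ (Fin 3)) (P : ℕ → ℝ → UnitAddTorus (Fin 3) → ℝ)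
    (R : ℕ → ℝ → UnitAddTorus (Fin 3) → Fin 3 → EuclideanSpace ℝ (Fin 3)),
    0 < ν₀ → 0 < σ → σ < 1 → 0 < ε → IsK41Tower f ν₀ σ A B E ε τ U P R →
    ∃ (N : ℕ) (D : ℝ) (τ' : ℕ → ℝ) (u : ℕ → ℝ → UnitAddTorus (Fin 3) → EuclideanSpace ℝ (Fin 3))
      (p : ℕ → ℝ → UnitAddTorus (Fin 3) → ℝ), ∀ n, N ≤ n →
      IsClassicalNSSolutionOn Set.univ (ν₀ * σ ^ n) (fun _ => f) (u n) (p n) ∧ 0 < τ' n ∧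
      Function.Periodic (u n) (τ' n) ∧ meanEnergy (u n - U n) ≤ D * Real.sqrt (ν₀ * σ ^ n) := by
  sorry

/-- **stub_powerContinuity** (support-grade) — the mean injected power is Lipschitz in the r.m.s. shadowing
distance: for smooth `f` and jointly smooth time-periodic fields `a`, `b` (own periods),
`⟨∫⟪f, b⟫⟩ ≤ ⟨∫⟪f, a⟫⟩ + ‖f‖₂ · √⟨‖a − b‖₂²⟩` (Cauchy–Schwarz in `x`, Jensen
`T⁻¹∫√· ≤ √(T⁻¹∫·)` for the running means, `limsup (p + q) ≤ limsup p + limsup q`, `√` monotone and continuous). -/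
theorem stub_powerContinuity : ∀ f : UnitAddTorus (Fin 3) → EuclideanSpace ℝ (Fin 3), IsSmooth f →
    ∀ (a b : ℝ → UnitAddTorus (Fin 3) → EuclideanSpace ℝ (Fin 3)) (τa τb : ℝ),
    IsSmoothSpaceTimeOn Set.univ a → IsSmoothSpaceTimeOn Set.univ b → 0 < τa → Function.Periodic a τa →
    0 < τb → Function.Periodic b τb →
    longTimeAvgSup (fun t => ∫ x, ⟪f x, b t x⟫_ℝ) ≤
      longTimeAvgSup (fun t => ∫ x, ⟪f x, a t x⟫_ℝ) + Real.sqrt (∫ x, ‖f x‖ ^ 2) * Real.sqrt (meanEnergy (a - b)) := by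
  sorry

/-- **Composition** `TowerClosing_of : stub_shadow → stub_powerContinuity → TowerClosing` (real proof).
Shadows `u_n` for `n ≥ N` with `⟨‖u_n − U_n‖²⟩ ≤ D√ν_n`; the tower's injection floor and power continuity give
`⟨∫⟪f,u_n⟫⟩ ≥ ε − ‖f‖₂ √(D√ν_n)`; since `ν_n = ν₀σⁿ → 0` the loss is `≤ ε/2` for `n ≥ N₁`; take
`N' = max N N₁`, `θ = 1/2`. -/
theorem TowerClosing_of
    (h₁ : ∀ f : UnitAddTorus (Fin 3) → EuclideanSpace ℝ (Fin 3), IsSmooth f → IsDivFree f →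
      HasZeroMean f → ∀ (ν₀ σ A B E ε : ℝ) (τ : ℕ → ℝ)
      (U : ℕ → ℝ → UnitAddTorus (Fin 3) → EuclideanSpace ℝ (Fin 3)) (P : ℕ → ℝ → UnitAddTorus (Fin 3) → ℝ)
      (R : ℕ → ℝ → UnitAddTorus (Fin 3) → Fin 3 → EuclideanSpace ℝ (Fin 3)),
      0 < ν₀ → 0 < σ → σ < 1 → 0 < ε → IsK41Tower f ν₀ σ A B E ε τ U P R →
      ∃ (N : ℕ) (D : ℝ) (τ' : ℕ → ℝ) (u : ℕ → ℝ → UnitAddTorus (Fin 3) → EuclideanSpace ℝ (Fin 3))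
        (p : ℕ → ℝ → UnitAddTorus (Fin 3) → ℝ), ∀ n, N ≤ n →
        IsClassicalNSSolutionOn Set.univ (ν₀ * σ ^ n) (fun _ => f) (u n) (p n) ∧ 0 < τ' n ∧
        Function.Periodic (u n) (τ' n) ∧ meanEnergy (u n - U n) ≤ D * Real.sqrt (ν₀ * σ ^ n))
    (h₂ : ∀ f : UnitAddTorus (Fin 3) → EuclideanSpace ℝ (Fin 3), IsSmooth f →
      ∀ (a b : ℝ → UnitAddTorus (Fin 3) → EuclideanSpace ℝ (Fin 3)) (τa τb : ℝ),
      IsSmoothSpaceTimeOn Set.univ a → IsSmoothSpaceTimeOn Set.univ b → 0 < τa → Function.Periodic a τa →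
      0 < τb → Function.Periodic b τb →
      longTimeAvgSup (fun t => ∫ x, ⟪f x, b t x⟫_ℝ) ≤
        longTimeAvgSup (fun t => ∫ x, ⟪f x, a t x⟫_ℝ) + Real.sqrt (∫ x, ‖f x‖ ^ 2) * Real.sqrt (meanEnergy (a - b))) :
    TowerSplit.TowerClosing := by
  intro f hf hdiv hmean ν₀ σ A B E ε τ U P R hν₀ hσ0 hσ1 hε hT
  obtain ⟨N, D, τ', u, p, hsh⟩ := h₁ f hf hdiv hmean ν₀ σ A B E ε τ U P R hν₀ hσ0 hσ1 hε hT
  -- the loss `‖f‖₂ √(D √ν_n)` tends to zero along the geometric ladder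
  set F : ℝ := Real.sqrt (∫ x, ‖f x‖ ^ 2) with hF
  have hνn : Tendsto (fun n : ℕ => ν₀ * σ ^ n) atTop (𝓝 0) := by
    simpa using (tendsto_pow_atTop_nhds_zero_of_lt_one hσ0.le hσ1).const_mul ν₀
  have hloss : Tendsto (fun n : ℕ => F * Real.sqrt (D * Real.sqrt (ν₀ * σ ^ n))) atTop (𝓝 0) := by
    have h1 : Tendsto (fun n : ℕ => Real.sqrt (ν₀ * σ ^ n)) atTop (𝓝 0) := by
      have h := hνn.sqrt
      rwa [Real.sqrt_zero] at h
    have h2 : Tendsto (fun n : ℕ => D * Real.sqrt (ν₀ * σ ^ n)) atTop (𝓝 0) := by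
      have h := h1.const_mul D
      rwa [mul_zero] at h
    have h3 : Tendsto (fun n : ℕ => Real.sqrt (D * Real.sqrt (ν₀ * σ ^ n))) atTop (𝓝 0) := by
      have h := h2.sqrt
      rwa [Real.sqrt_zero] at h
    have h4 := h3.const_mul F
    rwa [mul_zero] at h4
  obtain ⟨N₁, hN₁⟩ := eventually_atTop.1 (hloss.eventually (eventually_le_nhds (half_pos hε)))
  refine ⟨max N N₁, D, 1 / 2, τ', u, p, by norm_num, fun n hn => ?_⟩
  have hnN : N ≤ n := le_trans (le_max_left _ _) hn
  have hnN₁ : N₁ ≤ n := le_trans (le_max_right _ _) hn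
  obtain ⟨hsol, hτn, hper, hshadow⟩ := hsh n hnN
  obtain ⟨hτU, hperU, -, -, -, -, hsolU, -, -, -, hinj⟩ := hT n
  refine ⟨hsol, hτn, hper, hshadow, ?_⟩
  -- power continuity between the shadow `u n` and the tower state `U n`
  have hpc := h₂ f hf (u n) (U n) (τ' n) (τ n) hsol.smooth_velocity hsolU.smooth_velocity hτn hper hτU hperU
  have hsq : Real.sqrt (meanEnergy (u n - U n)) ≤ Real.sqrt (D * Real.sqrt (ν₀ * σ ^ n)) :=
    Real.sqrt_le_sqrt hshadow
  have hF0 : 0 ≤ F := Real.sqrt_nonneg _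
  have hmul : F * Real.sqrt (meanEnergy (u n - U n)) ≤ F * Real.sqrt (D * Real.sqrt (ν₀ * σ ^ n)) :=
    mul_le_mul_of_nonneg_left hsq hF0
  have hl := hN₁ n hnN₁
  linarith

/-- The skeleton closes the piece: `TowerClosing` from the two stubs. -/
theorem TowerClosing_holds_of_stubs : TowerSplit.TowerClosing :=
  TowerClosing_of stub_shadow stub_powerContinuity

end Summit.AnomalousDissipation.AnomalousDissipation.Cruxes.BoussinesqLadder.TowerClosingBirth

end
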